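import Mathlib
import Summits.Parity.GeneralizedHardyLittlewood.Theses.LiouvilleShiftedTables
import Summits.Parity.GeneralizedHardyLittlewood.Theorems.TableChowla.Negative.TableChowlaExceptionalSet

/-!
# Auxiliary lemmas for `stub_periodic_of_bv`

Line `helson-kronecker-inverse` of crux `LiouvilleShiftedTables.TableChowla` (stmt-Parity-14270).

Bookkeeping for the periodic residual of the mean-square dispersion of the shifted multiplication
table `(λ(ab+c))` against `q`-periodic 1-bounded column weights, reduced to ONE instance of
Bombieri–Vinogradov for `λ` (`LiouvilleShiftedTables.BVLiouville`) per residue class: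

* `norm_sum_periodic_le`: on a class `r mod q` the weight is constant, so
  `‖∑_b g(b) F(b)‖ ≤ ∑_{r<q} |∑_{b ≡ r (q)} F(b)|`;
* `periodic_classSum_le` (registered sub-goal of stmt-Parity-14270, proved last): each class sum
  `S(a,r) = ∑_{b ≤ Y, b ≡ r (q)} λ(ab+c)` is `λ` along ONE progression of modulus `aq` with a
  residue in `[0, aq)`, up to one boundary term: `|S(a,r)| ≤ |∑_{n ≤ m} λ(aq·n + ρ)| + 1`,
  `q·m ≤ Y`;
* `sum_rows_bvInner_le`: distinct rows `a` give distinct moduli `aq`, so the sum over the rows of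
  the BV inner sums is bounded by one instance of `BVLiouville` (passed as a hypothesis `hBVX`);
* `final_bound`: the real-variable assembly of sizes.

No new definitions are introduced; `λ` at an integer `n` is `(liouville (Int.toNat n) : ℝ)` as in
the route file.
-/

namespace Summit.Parity.GeneralizedHardyLittlewood.Theorems.TableChowla.HelsonKroneckerInverse

namespace PeriodicOfBV

open Finset ArithmeticFunction
open Summit.Parity.GeneralizedHardyLittlewood.Theses.LiouvilleShiftedTables

noncomputable section

/-! ## Elementary pieces -/

/-- `|λ| ≤ 1` (at an integer argument via `Int.toNat`). -/
theorem abs_lamZ_le_one (n : ℤ) : |(liouville (Int.toNat n) : ℝ)| ≤ 1 := by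
  rcases eq_or_ne (Int.toNat n) 0 with h | h
  · simp [h]
  · rw [ArithmeticFunction.liouville_apply h]
    push_cast
    rw [abs_pow, abs_neg, abs_one, one_pow]

/-- The class `0 mod q` of `[1, Y]` is `{q·j : 1 ≤ j ≤ Y/q}`. -/
theorem filter_mod_zero_eq (q Y : ℕ) (hq : 0 < q) :
    (Icc 1 Y).filter (fun b => b % q = 0) = (Icc 1 (Y / q)).image (fun j => q * j) := by
  ext b
  simp only [mem_filter, mem_Icc, mem_image]
  constructor
  · rintro ⟨⟨hb1, hbY⟩, hbq⟩
    refine ⟨b / q, ⟨Nat.div_pos (Nat.le_of_dvd hb1 (Nat.dvd_of_mod_eq_zero hbq)) hq,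
      Nat.div_le_div_right hbY⟩, ?_⟩
    have := Nat.div_add_mod b q
    rw [hbq] at this
    omega
  · rintro ⟨j, ⟨hj1, hjY⟩, rfl⟩
    refine ⟨⟨?_, ?_⟩, Nat.mul_mod_right q j⟩
    · exact Nat.le_mul_of_pos_right q hj1 |>.trans' hq
    · exact (Nat.mul_le_mul_left q hjY).trans (Nat.mul_div_le Y q)

/-- The class `r mod q` of `[1, Y]`, `1 ≤ r < q`, `r ≤ Y`, is `{q·j + r : 0 ≤ j ≤ (Y-r)/q}`. -/
theorem filter_mod_eq (q Y r : ℕ) (hq : 0 < q) (hr : r < q) (hr1 : 1 ≤ r) (hrY : r ≤ Y) :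
    (Icc 1 Y).filter (fun b => b % q = r) = (Icc 0 ((Y - r) / q)).image (fun j => q * j + r) := by
  ext b
  simp only [mem_filter, mem_Icc, mem_image]
  constructor
  · rintro ⟨⟨_, hbY⟩, hbq⟩
    refine ⟨b / q, ⟨Nat.zero_le _, ?_⟩, ?_⟩
    · rw [Nat.le_div_iff_mul_le hq]
      have := Nat.div_add_mod b q
      rw [hbq] at this
      have h2 : b / q * q = q * (b / q) := mul_comm _ _
      omega
    · have := Nat.div_add_mod b q
      rw [hbq] at this
      omega
  · rintro ⟨j, ⟨_, hjY⟩, rfl⟩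
    rw [Nat.le_div_iff_mul_le hq] at hjY
    refine ⟨⟨by omega, ?_⟩, ?_⟩
    · have h2 : j * q = q * j := mul_comm _ _
      omega
    · rw [Nat.mul_add_mod]
      exact Nat.mod_eq_of_lt hr

/-- The class `r mod q` of `[1, Y]` is empty when `r > Y`. -/
theorem filter_mod_eq_empty (q Y r : ℕ) (hrY : Y < r) :
    (Icc 1 Y).filter (fun b => b % q = r) = ∅ := by
  ext b
  simp only [mem_filter, mem_Icc, Finset.notMem_empty, iff_false, not_and]
  rintro ⟨_, hbY⟩ hbq
  have := Nat.mod_le b q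
  omega

/-- Splitting off the `j = 0` term of a sum over `[0, M]`. -/
theorem sum_Icc_zero_eq (M : ℕ) (G : ℕ → ℝ) :
    ∑ j ∈ Icc 0 M, G j = G 0 + ∑ j ∈ Icc 1 M, G j := by
  rw [← insert_Icc_add_one_left_eq_Icc (Nat.zero_le M), sum_insert (by simp), zero_add]

/-- Shifting a sum over `[1, M]` down to `[0, M-1]`. -/
theorem sum_Icc_one_eq_shift (M : ℕ) (hM : 1 ≤ M) (G : ℕ → ℝ) :
    ∑ j ∈ Icc 1 M, G j = ∑ k ∈ Icc 0 (M - 1), G (k + 1) := by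
  have : Icc 1 M = (Icc 0 (M - 1)).map (addRightEmbedding 1) := by
    rw [map_add_right_Icc, zero_add, Nat.sub_add_cancel hM]
  rw [this, sum_map]
  rfl

/-! ## Periodic weights: reduction to class sums -/

/-- For `q`-periodic 1-bounded weights, `‖∑_b g(b) F(b)‖ ≤ ∑_{r<q} |∑_{b ≡ r (q)} F(b)|`. -/
theorem norm_sum_periodic_le {g : ℕ → ℂ} {q : ℕ} (hq : 0 < q) (hper : Function.Periodic g q)
    (hg1 : ∀ n, ‖g n‖ ≤ 1) (s : Finset ℕ) (F : ℕ → ℝ) :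
    ‖∑ b ∈ s, g b * (F b : ℂ)‖ ≤ ∑ r ∈ range q, |∑ b ∈ s.filter (fun b => b % q = r), F b| := by
  rw [← sum_fiberwise_of_maps_to (s := s) (t := range q) (g := fun b => b % q)
    (fun b _ => mem_range.mpr (Nat.mod_lt b hq))]
  refine (norm_sum_le _ _).trans (sum_le_sum fun r _ => ?_)
  have hfac : ∑ b ∈ s.filter (fun b => b % q = r), g b * (F b : ℂ) =
      g r * ((∑ b ∈ s.filter (fun b => b % q = r), F b : ℝ) : ℂ) := by
    rw [Complex.ofReal_sum, mul_sum]
    refine sum_congr rfl fun b hb => ?_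
    rw [← hper.map_mod_nat b, (mem_filter.mp hb).2]
  rw [hfac, norm_mul, Complex.norm_real, Real.norm_eq_abs]
  have := hg1 r
  have h0 : 0 ≤ |∑ b ∈ s.filter (fun b => b % q = r), F b| := abs_nonneg _
  nlinarith [norm_nonneg (g r)]

/-- Trivial bound: `‖∑_{b ≤ Y} g(b) λ(ab+c)‖ ≤ Y`. -/
theorem norm_sum_le_card {g : ℕ → ℂ} (hg1 : ∀ n, ‖g n‖ ≤ 1) (c : ℤ) (Y a : ℕ) :
    ‖∑ b ∈ Icc 1 Y, g b * ((liouville (Int.toNat ((a : ℤ) * b + c)) : ℝ) : ℂ)‖ ≤ Y := by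
  refine (norm_sum_le _ _).trans ?_
  calc ∑ b ∈ Icc 1 Y, ‖g b * ((liouville (Int.toNat ((a : ℤ) * b + c)) : ℝ) : ℂ)‖
      ≤ ∑ _b ∈ Icc 1 Y, (1 : ℝ) := by
        refine sum_le_sum fun b _ => ?_
        rw [norm_mul, Complex.norm_real, Real.norm_eq_abs]
        have h1 := hg1 b
        have h2 := abs_lamZ_le_one ((a : ℤ) * b + c)
        nlinarith [norm_nonneg (g b), abs_nonneg (liouville (Int.toNat ((a : ℤ) * b + c)) : ℝ)]
    _ = Y := by simp

/-! ## One instance of Bombieri–Vinogradov per residue class -/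

/-- Re-indexing the rows `a` into the moduli `d = aq` of ONE instance of `BVLiouville`: if the
residues `ρ a ∈ [0, aq)` and lengths `m a` (`aq · m a ≤ X`) are given on the rows, the moduli
`aq ≤ D` are distinct, and BV at scale `X`, level `D` bounds every admissible choice by `B`, then
`∑_{a ∈ rows} |∑_{1 ≤ n ≤ m a} λ(aq·n + ρ a)| ≤ B`. -/
theorem sum_rows_bvInner_le {q : ℕ} (hq : 0 < q) {rows : Finset ℕ} {D : ℕ}
    (hrows : ∀ a ∈ rows, 0 < a) (hD : ∀ a ∈ rows, a * q ≤ D) {X B : ℝ} (hX : 0 ≤ X)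
    (ρ : ℕ → ℤ) (m : ℕ → ℕ) (hρ : ∀ a ∈ rows, 0 ≤ ρ a ∧ ρ a < ((a * q : ℕ) : ℤ))
    (hm : ∀ a ∈ rows, ((a * q : ℕ) : ℝ) * m a ≤ X)
    (hBVX : ∀ cf : ℕ → ℤ, ∀ yf : ℕ → ℝ, (∀ d, 1 ≤ d → 0 ≤ cf d ∧ cf d < d) →
      (∀ d, 0 ≤ yf d ∧ yf d ≤ X) →
      ∑ d ∈ Icc 1 D, |∑ n ∈ Icc 1 ⌊yf d / d⌋₊,
        (liouville (Int.toNat ((d : ℤ) * n + cf d)) : ℝ)| ≤ B) :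
    ∑ a ∈ rows, |∑ n ∈ Icc 1 (m a), (liouville (Int.toNat (((a * q : ℕ) : ℤ) * n + ρ a)) : ℝ)|
      ≤ B := by
  classical
  -- the residue / height selectors of this BV instance
  set cf : ℕ → ℤ := fun d => if d % q = 0 ∧ d / q ∈ rows then ρ (d / q) else 0 with hcf
  set yf : ℕ → ℝ := fun d => if d % q = 0 ∧ d / q ∈ rows then (d : ℝ) * m (d / q) else 0 with hyf
  have hcf_ok : ∀ d, 1 ≤ d → 0 ≤ cf d ∧ cf d < d := by
    intro d hd
    simp only [hcf]
    split_ifs with h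
    · have hdq : d / q * q = d := Nat.div_mul_cancel (Nat.dvd_of_mod_eq_zero h.1)
      have := hρ (d / q) h.2
      rw [hdq] at this
      exact this
    · exact ⟨le_rfl, by exact_mod_cast hd⟩
  have hyf_ok : ∀ d, 0 ≤ yf d ∧ yf d ≤ X := by
    intro d
    simp only [hyf]
    split_ifs with h
    · have hdq : d / q * q = d := Nat.div_mul_cancel (Nat.dvd_of_mod_eq_zero h.1)
      have := hm (d / q) h.2
      rw [hdq] at this
      exact ⟨by positivity, this⟩
    · exact ⟨le_rfl, hX⟩
  have hinj : Set.InjOn (fun a => a * q) ↑rows := fun a₁ _ a₂ _ h =>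
    Nat.eq_of_mul_eq_mul_right hq h
  have key : ∀ a ∈ rows,
      |∑ n ∈ Icc 1 (m a), (liouville (Int.toNat (((a * q : ℕ) : ℤ) * n + ρ a)) : ℝ)| =
      |∑ n ∈ Icc 1 ⌊yf (a * q) / (a * q : ℕ)⌋₊,
        (liouville (Int.toNat (((a * q : ℕ) : ℤ) * n + cf (a * q))) : ℝ)| := by
    intro a ha
    have h1 : a * q % q = 0 := Nat.mul_mod_left a q
    have h2 : a * q / q = a := Nat.mul_div_cancel a hq
    have hcond : a * q % q = 0 ∧ a * q / q ∈ rows := ⟨h1, by rw [h2]; exact ha⟩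
    have hc' : cf (a * q) = ρ a := by simp only [hcf, if_pos hcond, h2]
    have hy' : yf (a * q) = ((a * q : ℕ) : ℝ) * m a := by simp only [hyf, if_pos hcond, h2]
    have haq0 : ((a * q : ℕ) : ℝ) ≠ 0 := by
      have : 0 < a * q := Nat.mul_pos (hrows a ha) hq
      positivity
    rw [hc', hy', mul_div_cancel_left₀ _ haq0, Nat.floor_natCast]
  calc ∑ a ∈ rows, |∑ n ∈ Icc 1 (m a), (liouville (Int.toNat (((a * q : ℕ) : ℤ) * n + ρ a)) : ℝ)|
      = ∑ a ∈ rows, |∑ n ∈ Icc 1 ⌊yf (a * q) / (a * q : ℕ)⌋₊,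
          (liouville (Int.toNat (((a * q : ℕ) : ℤ) * n + cf (a * q))) : ℝ)| :=
        sum_congr rfl key
    _ = ∑ d ∈ rows.image (fun a => a * q), |∑ n ∈ Icc 1 ⌊yf d / d⌋₊,
          (liouville (Int.toNat ((d : ℤ) * n + cf d)) : ℝ)| := by
        rw [sum_image hinj]
    _ ≤ ∑ d ∈ Icc 1 D, |∑ n ∈ Icc 1 ⌊yf d / d⌋₊,
          (liouville (Int.toNat ((d : ℤ) * n + cf d)) : ℝ)| := by
        refine sum_le_sum_of_subset_of_nonneg ?_ fun _ _ _ => abs_nonneg _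
        intro d hd
        obtain ⟨a, ha, rfl⟩ := mem_image.mp hd
        exact mem_Icc.mpr ⟨Nat.mul_pos (hrows a ha) hq, hD a ha⟩
    _ ≤ B := hBVX cf yf hcf_ok hyf_ok

/-! ## The final real-variable inequality -/

/-- Assembly of sizes: with `Y ≤ x/A`, `q ≤ L^K`, `4 C_b ≤ L`, `rows ≤ 2A` and
`4 L^{K+C} ≤ x/A`, one has `Y·q·(2 C_b x / L^{C+K+1} + rows) ≤ x (x/A) / L^C`. -/
theorem final_bound {x A L Y q Cb R K C : ℝ} (hx : 0 < x) (hA : 0 < A) (hL : 0 < L)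
    (hY : Y ≤ x / A) (hq0 : 0 ≤ q) (hq : q ≤ L ^ K) (hCb : 0 ≤ Cb)
    (hCbL : 4 * Cb ≤ L) (hR0 : 0 ≤ R) (hR : R ≤ 2 * A) (hwin : 4 * L ^ (K + C) ≤ x / A) :
    Y * (q * (Cb * (2 * x) / L ^ (C + K + 1) + R)) ≤ x * (x / A) / L ^ C := by
  have hLC : 0 < L ^ C := Real.rpow_pos_of_pos hL C
  have hLK : 0 < L ^ K := Real.rpow_pos_of_pos hL K
  have hP : 0 ≤ x * (x / A) / L ^ C := by positivity
  have hYq : Y * q ≤ x / A * L ^ K := mul_le_mul hY hq hq0 (by positivity)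
  have hpow1 : L ^ (C + K + 1) = L ^ C * L ^ K * L := by
    rw [Real.rpow_add hL, Real.rpow_add hL, Real.rpow_one]
  have hpow2 : L ^ (K + C) = L ^ K * L ^ C := Real.rpow_add hL K C
  -- first term
  have hT1 : Y * (q * (Cb * (2 * x) / L ^ (C + K + 1))) ≤ x * (x / A) / L ^ C / 2 := by
    rw [hpow1]
    calc Y * (q * (Cb * (2 * x) / (L ^ C * L ^ K * L)))
        = (Y * q) * (Cb * (2 * x) / (L ^ C * L ^ K * L)) := by ring
      _ ≤ (x / A * L ^ K) * (Cb * (2 * x) / (L ^ C * L ^ K * L)) :=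
          mul_le_mul_of_nonneg_right hYq (by positivity)
      _ = (x * (x / A) / L ^ C) * (2 * Cb / L) := by
          field_simp
      _ ≤ (x * (x / A) / L ^ C) * (1 / 2) := by
          refine mul_le_mul_of_nonneg_left ?_ hP
          rw [div_le_div_iff₀ hL two_pos]
          linarith
      _ = x * (x / A) / L ^ C / 2 := by ring
  -- second term
  have hT2 : Y * (q * R) ≤ x * (x / A) / L ^ C / 2 := by
    calc Y * (q * R) = (Y * q) * R := by ring
      _ ≤ (x / A * L ^ K) * (2 * A) := mul_le_mul hYq hR hR0 (by positivity)
      _ = 2 * x * L ^ K := by field_simp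
      _ ≤ 2 * x * L ^ K * ((x / A) / (4 * L ^ (K + C))) := by
          refine le_mul_of_one_le_right (by positivity) ?_
          rw [one_le_div (by positivity)]
          exact hwin
      _ = x * (x / A) / L ^ C / 2 := by
          rw [hpow2]
          field_simp
          ring
  calc Y * (q * (Cb * (2 * x) / L ^ (C + K + 1) + R))
      = Y * (q * (Cb * (2 * x) / L ^ (C + K + 1))) + Y * (q * R) := by ring
    _ ≤ x * (x / A) / L ^ C / 2 + x * (x / A) / L ^ C / 2 := add_le_add hT1 hT2
    _ = x * (x / A) / L ^ C := by ring

end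

end PeriodicOfBV

/-! ## Each class sum is `λ` on one progression (registered sub-goal `periodic_classSum_le`) -/

section
open Finset ArithmeticFunction PeriodicOfBV

/-- **Registered sub-goal `periodic_classSum_le`** (supports stmt-Parity-14270, stub
`stub_periodic_of_bv`). For `|c| < a` and `r < q`, the class sum
`S(a,r) = ∑_{1 ≤ b ≤ Y, b ≡ r (q)} λ(ab+c)` is, up to one boundary term, a Bombieri–Vinogradov inner
sum `∑_{1 ≤ n ≤ m} λ(d n + ρ)` of modulus `d = aq`, residue `ρ ∈ [0, aq)` and length `m` with
`q·m ≤ Y`: `|S(a,r)| ≤ |∑_{1 ≤ n ≤ m} λ(aq·n + ρ)| + 1`. -/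
theorem periodic_classSum_le :
    ∀ c : ℤ, ∀ q Y a r : ℕ, 0 < q → r < q → |c| < (a : ℤ) →
      ∃ ρ : ℤ, ∃ m : ℕ, 0 ≤ ρ ∧ ρ < ((a * q : ℕ) : ℤ) ∧ q * m ≤ Y ∧
        |∑ b ∈ (Finset.Icc 1 Y).filter (fun b : ℕ => b % q = r),
            (ArithmeticFunction.liouville (Int.toNat ((a : ℤ) * b + c)) : ℝ)| ≤
          |∑ n ∈ Finset.Icc 1 m,
            (ArithmeticFunction.liouville (Int.toNat (((a * q : ℕ) : ℤ) * n + ρ)) : ℝ)| + 1 := by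
  intro c q Y a r hq hr hca
  have hc1 : -(a : ℤ) < c := by have := neg_abs_le c; linarith
  have hc2 : c < (a : ℤ) := lt_of_le_of_lt (le_abs_self c) hca
  have ha0 : (0 : ℤ) < a := lt_of_le_of_lt (abs_nonneg c) hca
  have hq1 : (1 : ℤ) ≤ q := by exact_mod_cast hq
  have haq : (a : ℤ) ≤ ((a * q : ℕ) : ℤ) := by
    push_cast; exact le_mul_of_one_le_right ha0.le hq1
  rcases Nat.eq_zero_or_pos r with rfl | hr1
  · -- the class `0 mod q`: `b = q j`, `1 ≤ j ≤ Y/q`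
    have hS : ∑ b ∈ (Icc 1 Y).filter (fun b => b % q = 0),
          (liouville (Int.toNat ((a : ℤ) * b + c)) : ℝ) =
        ∑ j ∈ Icc 1 (Y / q), (liouville (Int.toNat ((a : ℤ) * ((q * j : ℕ) : ℤ) + c)) : ℝ) := by
      rw [filter_mod_zero_eq q Y hq, sum_image]
      intro j₁ _ j₂ _ h
      exact Nat.eq_of_mul_eq_mul_left hq h
    rcases le_or_gt 0 c with hc0 | hc0
    · -- residue `c ∈ [0, aq)`, no boundary term
      refine ⟨c, Y / q, hc0, lt_of_lt_of_le hc2 haq, Nat.mul_div_le Y q, ?_⟩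
      have : ∑ b ∈ (Icc 1 Y).filter (fun b => b % q = 0),
            (liouville (Int.toNat ((a : ℤ) * b + c)) : ℝ) =
          ∑ n ∈ Icc 1 (Y / q), (liouville (Int.toNat (((a * q : ℕ) : ℤ) * n + c)) : ℝ) := by
        rw [hS]
        refine sum_congr rfl fun j _ => ?_
        push_cast; ring_nf
      rw [this]
      linarith [abs_nonneg
        (∑ n ∈ Icc 1 (Y / q), (liouville (Int.toNat (((a * q : ℕ) : ℤ) * n + c)) : ℝ))]
    · -- residue `c + aq ∈ [0, aq)`, shift `n = j - 1`, boundary term `n = 0`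
      set M := Y / q with hM
      refine ⟨c + ((a * q : ℕ) : ℤ), M - 1, by linarith, by linarith, ?_, ?_⟩
      · exact (Nat.mul_le_mul_left q (Nat.sub_le M 1)).trans (Nat.mul_div_le Y q)
      rcases Nat.eq_zero_or_pos M with hM0 | hM1
      · rw [hS, hM0, Icc_eq_empty_of_lt zero_lt_one, sum_empty, abs_zero]
        positivity
      · rw [hS, sum_Icc_one_eq_shift M hM1, sum_Icc_zero_eq]
        have : ∑ k ∈ Icc 1 (M - 1),
              (liouville (Int.toNat ((a : ℤ) * ((q * (k + 1) : ℕ) : ℤ) + c)) : ℝ) =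
            ∑ n ∈ Icc 1 (M - 1),
              (liouville (Int.toNat (((a * q : ℕ) : ℤ) * n + (c + ((a * q : ℕ) : ℤ)))) : ℝ) := by
          refine sum_congr rfl fun k _ => ?_
          push_cast; ring_nf
        rw [this]
        refine (abs_add_le _ _).trans ?_
        linarith [abs_lamZ_le_one ((a : ℤ) * ((q * (0 + 1) : ℕ) : ℤ) + c)]
  · rcases le_or_gt r Y with hrY | hrY
    · -- the class `r mod q`, `1 ≤ r < q`: `b = q j + r`, `0 ≤ j ≤ (Y-r)/q`, boundary term `j = 0`
      set M := (Y - r) / q with hM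
      have hρ0 : 0 ≤ (a : ℤ) * r + c := by
        have : (a : ℤ) ≤ (a : ℤ) * r := le_mul_of_one_le_right ha0.le (by exact_mod_cast hr1)
        linarith
      have hρ1 : (a : ℤ) * r + c < ((a * q : ℕ) : ℤ) := by
        have h1 : (r : ℤ) + 1 ≤ q := by exact_mod_cast hr
        have : (a : ℤ) * (r + 1) ≤ (a : ℤ) * q := mul_le_mul_of_nonneg_left h1 ha0.le
        push_cast; linarith
      refine ⟨(a : ℤ) * r + c, M, hρ0, hρ1, ?_, ?_⟩
      · exact (Nat.mul_div_le (Y - r) q).trans (Nat.sub_le Y r)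
      have hS : ∑ b ∈ (Icc 1 Y).filter (fun b => b % q = r),
            (liouville (Int.toNat ((a : ℤ) * b + c)) : ℝ) =
          ∑ j ∈ Icc 0 M, (liouville (Int.toNat ((a : ℤ) * ((q * j + r : ℕ) : ℤ) + c)) : ℝ) := by
        rw [filter_mod_eq q Y r hq hr hr1 hrY, sum_image]
        intro j₁ _ j₂ _ h
        simp only [add_left_inj] at h
        exact Nat.eq_of_mul_eq_mul_left hq h
      rw [hS, sum_Icc_zero_eq]
      have : ∑ j ∈ Icc 1 M, (liouville (Int.toNat ((a : ℤ) * ((q * j + r : ℕ) : ℤ) + c)) : ℝ) =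
          ∑ n ∈ Icc 1 M,
            (liouville (Int.toNat (((a * q : ℕ) : ℤ) * n + ((a : ℤ) * r + c))) : ℝ) := by
        refine sum_congr rfl fun j _ => ?_
        push_cast; ring_nf
      rw [this]
      refine (abs_add_le _ _).trans ?_
      linarith [abs_lamZ_le_one ((a : ℤ) * ((q * 0 + r : ℕ) : ℤ) + c)]
    · -- the class is empty
      refine ⟨0, 0, le_rfl, lt_of_lt_of_le ha0 haq, by omega, ?_⟩
      rw [filter_mod_eq_empty q Y r hrY, sum_empty, abs_zero]
      positivity

end

end Summit.Parity.GeneralizedHardyLittlewood.Theorems.TableChowla.HelsonKroneckerInverse
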